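import Summits.Ventures.YMGap.RobustBall.ZdAxisClustering
import Summits.Ventures.YMGap.RobustBall.MassGapOfDoorKR
import Literature.MathematicalPhysics.QuantumFieldTheory.Balaban1983to89.StrongCouplingKernelWindow
import HarnessLib

/-!
# Robust ball (Y2) — axis-rate clustering UNIFORM IN THE TIER-1 LOADS of a perturbed `SU(N)` specification on `ℤ^d` (oscillation `a`,
# self-Lipschitz load `ℓ_s`, cross loads `ℓ` of range `R` with rows `≤ Λ`): every DLR state of such a specification inside the Kantorovich–Rubinstein
# door clusters along a lattice axis at the single-entry rate, the cross loads entering with weight `φ^{−(2R+1)}` (no `MemBallZdW` hypothesis is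
# taken or produced here — the typed-ball corollary is the successor's, cf. ds-2's `RobustStarDoorZdW`)

HONEST FRAMING: venture file of the cell `pub-ymgap` (QuantumFields programme), track ROBUST-BALL, seat rb-p2 (g10).  Strong-coupling LATTICE floor on the
decay of truncated correlations along an axis for DLR states of perturbed specifications on `ℤ^d` (rb-p1's `perturbedYM`, ds-4's KR door
`isKRContraction_perturbedYM_of_oneLinkKRModulus`); the uniqueness window is the tree's and is not touched; nothing continuum / Clay.
CONTENT.  (1) `abs_cov_le_axis_of_split` — GENERIC: any specification `γ` on the `ℤ^d` links with a KR contraction whose matrix splits as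
`C(e,y) ≤ A·linkInfluence e y + L(e,y)`, `L ≥ 0` with rows `≤ Λ` supported within `ℓ∞`-distance `R` of `e`, rows of `C` `≤ ρ < 1`: along an axis `i`
the half-line vector `φ^{(a − H_i)_+}` is a supersolution as soon as `A·P_∥(φ) + Λ φ^{−(2R+1)} ≤ 1` and `A·P_⊥(φ) + Λ φ^{−(2R+1)} ≤ 1`
(`P_∥ = 2(d−1)(φ⁻¹+1+φ)`, `P_⊥ = φ⁻²+2φ⁻¹+2φ+φ²+6(d−2)`), whence `|cov_μ(f,g)| ≤ 8N(Σδ_g)(Σδ_f) φ^{2n}` for axis-separated supports and every Gibbs measure.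
(2) `perturbedYM_abs_cov_le_axis` — the member version through the KR door: `A = K e^{a}(1 + 2√N ℓ_s)|β|`, `L = √N·ℓ(e,y)`, `Λ ↦ √N Λ`.
At zero loads this is `ZdAxisClustering.ym_abs_cov_le_axis`.
-/

noncomputable section

open MeasureTheory ProbabilityTheory Filter Topology Function Finset Real
open scoped NNReal
open Literature.Probability.LatticeModels
open Literature.Probability.LatticeModels.DobrushinMetric
open Literature.MathematicalPhysics.QuantumLattice
open Literature.MathematicalPhysics.QuantumFieldTheory hiding ZdEdge
open Literature.MathematicalPhysics.QuantumFieldTheory.Balaban1983to89.StrongCouplingDobrushinWindow (OneLinkKRModulus)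
open Summit.Ventures.YMGap.RobustBall.DobrushinSupersolution Summit.Ventures.YMGap.RobustBall.ZdAxis

namespace Summit.Ventures.YMGap.RobustBall.ZdAxis

variable {d N : ℕ}

/-- Links within `ℓ∞`-distance `R` have doubled axis coordinates within `2R + 1`. [folklore] -/
theorem abs_offset_le_of_norm_le {e y : ZdEdge d} {R : ℕ} (h : ‖e.1 - y.1‖ ≤ (R : ℝ)) (i : Fin d) :
    |(2 * (y.1 i - e.1 i) + (if y.2 = i then 1 else 0) - (if e.2 = i then 1 else 0) : ℤ)| ≤ 2 * R + 1 := by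
  have h1 : |y.1 i - e.1 i| ≤ (R : ℤ) := by
    have h2 : ‖(e.1 - y.1) i‖ ≤ (R : ℝ) := (norm_le_pi_norm _ i).trans h
    rw [Pi.sub_apply, Int.norm_eq_abs] at h2
    have h3 : ((|e.1 i - y.1 i| : ℤ) : ℝ) ≤ R := by rw [Int.cast_abs]; exact h2
    rw [abs_sub_comm]
    exact_mod_cast h3
  rw [abs_le] at h1 ⊢
  constructor <;> split_ifs <;> omega

/-- **AXIS-RATE CLUSTERING FROM A SPLIT DOBRUSHIN MATRIX (generic `ℤ^d` door).**  Let `γ` be a specification of `SU(N)` link variables on `ℤ^d`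
(`d ≥ 2`) with a KR contraction `C` over `nbr` for the Frobenius weight, rows `≤ ρ < 1`, and a SPLIT `C(e,y) ≤ A·linkInfluence e y + L(e,y)` with
`A, L ≥ 0`, `∑_{y ∈ nbr e} L(e,y) ≤ Λ` and neighbourhoods of `ℓ∞`-range `≤ R`.  If `0 < φ ≤ 1` satisfies
`A·2(d−1)(φ⁻¹+1+φ) + Λφ⁻¹^{2R+1} ≤ 1` and `A(φ⁻¹²+2φ⁻¹+2φ+φ²+6(d−2)) + Λφ⁻¹^{2R+1} ≤ 1`, then every Gibbs measure `μ` of `γ` and all bounded measurable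
local `f, g` (Frobenius-Lipschitz vectors `δ_f, δ_g`) with `H_i ≥ a` on `Δ_g` and `H_i + 2n ≤ a` on `Δ_f` satisfy
`|cov_μ(f,g)| ≤ 8N(Σδ_g)(Σδ_f) φ^{2n}`. [cite: Follmer1988, Ch. I Theorem (2.13)] -/
theorem abs_cov_le_axis_of_split (hd : 2 ≤ d) {γ : Specification (ZdEdge d) (Matrix.specialUnitaryGroup (Fin N) ℂ)}
    (hγ : IsSpecification γ) {nbr : ZdEdge d → Finset (ZdEdge d)} {C : ZdEdge d → ZdEdge d → ℝ}
    (hKR : IsKRContraction γ suFrobDist nbr C) {ρ : ℝ} (hρ0 : 0 ≤ ρ) (hρ1 : ρ < 1) (hrow : ∀ e, ∑ y ∈ nbr e, C e y ≤ ρ)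
    {A Λ : ℝ} (hA : 0 ≤ A) {L : ZdEdge d → ZdEdge d → ℝ} (hL0 : ∀ e y, 0 ≤ L e y)
    (hsplit : ∀ e, ∀ y ∈ nbr e, C e y ≤ A * linkInfluence e y + L e y) (hLrow : ∀ e, ∑ y ∈ nbr e, L e y ≤ Λ)
    {R : ℕ} (hnbr : ∀ e, ∀ y ∈ nbr e, ‖e.1 - y.1‖ ≤ (R : ℝ))
    {φ : ℝ} (hφ0 : 0 < φ) (hφ1 : φ ≤ 1)
    (hpar : A * (2 * ((d - 1 : ℕ) : ℝ) * (φ⁻¹ + 1 + φ)) + Λ * φ⁻¹ ^ (2 * R + 1) ≤ 1)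
    (hperp : A * (φ⁻¹ ^ 2 + 2 * φ⁻¹ + 2 * φ + φ ^ 2 + 6 * ((d - 2 : ℕ) : ℝ)) + Λ * φ⁻¹ ^ (2 * R + 1) ≤ 1)
    {μ : Measure (LGConfig d (Matrix.specialUnitaryGroup (Fin N) ℂ))} (hμ : IsGibbsMeasure γ μ)
    {f g : LGConfig d (Matrix.specialUnitaryGroup (Fin N) ℂ) → ℝ} (hfm : Measurable f) {Δf : Finset (ZdEdge d)}
    (hfdep : DependsOn f (↑Δf : Set (ZdEdge d))) {Mf : ℝ} (hMf : ∀ σ, |f σ| ≤ Mf) {δf : ZdEdge d → ℝ}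
    (hδf : IsLipBound suFrobDist f δf) (hgm : Measurable g) {Δg : Finset (ZdEdge d)}
    (hgdep : DependsOn g (↑Δg : Set (ZdEdge d))) {Mg : ℝ} (hMg : ∀ σ, |g σ| ≤ Mg) {δg : ZdEdge d → ℝ}
    (hδg : IsLipBound suFrobDist g δg) (i : Fin d) (a : ℤ) (n : ℕ)
    (hga : ∀ y ∈ Δg, a ≤ 2 * y.1 i + (if y.2 = i then 1 else 0))
    (hfa : ∀ x ∈ Δf, 2 * x.1 i + (if x.2 = i then 1 else 0) + 2 * n ≤ a) :
    |cov[f, g; μ]| ≤ 8 * N * (∑ y ∈ Δg, δg y) * (∑ x ∈ Δf, δf x) * φ ^ (2 * n) := by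
  classical
  have hΛ0 : 0 ≤ Λ := by
    have hd0 : 0 < d := by omega
    let e₀ : ZdEdge d := (0, ⟨0, hd0⟩)
    exact (Finset.sum_nonneg fun y _ => hL0 e₀ y).trans (hLrow e₀)
  -- the half-line supersolution along the axis `i`
  set H : ZdEdge d → ℤ := fun z => 2 * z.1 i + (if z.2 = i then 1 else 0) with hH
  set v : ZdEdge d → ℝ := fun z => φ ^ max (a - H z) 0 with hv
  have hv0 : ∀ z, 0 ≤ v z := fun z => by simp only [hv]; exact zpow_nonneg hφ0.le _
  have hv1 : ∀ z, v z ≤ 1 := fun z => zpow_max_le_one hφ0 hφ1 _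
  have hvg : ∀ y ∈ Δg, 1 ≤ v y := fun y hy => by
    have : max (a - H y) 0 = 0 := max_eq_right (by have := hga y hy; simp only [hH]; omega)
    simp only [hv, this, zpow_zero, le_refl]
  have hφi1 : 1 ≤ φ⁻¹ := one_le_inv_iff₀.2 ⟨hφ0, hφ1⟩
  have hsuper : ∀ z ∉ Δg, ∑ w ∈ nbr z, C z w * v w ≤ v z := by
    intro z _
    by_cases hz : a - H z ≤ 0
    · have hvz : v z = 1 := by simp only [hv, max_eq_right hz, zpow_zero]
      rw [hvz]
      calc ∑ w ∈ nbr z, C z w * v w ≤ ∑ w ∈ nbr z, C z w * 1 :=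
            Finset.sum_le_sum fun w _ => mul_le_mul_of_nonneg_left (hv1 w) (hKR.nonneg z w)
        _ ≤ ρ := by simpa using hrow z
        _ ≤ 1 := hρ1.le
    · have hm : 1 ≤ a - H z := by omega
      set c : ℤ → ℝ := fun D => φ ^ (-D) with hc
      have hc0 : ∀ D, 0 ≤ c D := fun D => zpow_nonneg hφ0.le _
      have hratio : ∀ w : ZdEdge d, v w ≤ c (2 * (w.1 i - z.1 i) + (if w.2 = i then 1 else 0) - (if z.2 = i then 1 else 0)) * v z := by
        intro w
        have hD : a - H w = (a - H z) - (2 * (w.1 i - z.1 i) + (if w.2 = i then 1 else 0) - (if z.2 = i then 1 else 0)) := by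
          simp only [hH]; ring
        simp only [hv, hc]; rw [hD]; exact zpow_max_sub_le hφ0 hφ1 hm _
      -- Wilson part
      have keyW := sum_linkInfluence_mul_le_axis hd c hc0 z i hv0 hratio (nbr z)
      have hc1 : c 1 = φ⁻¹ := by simp [hc]
      have hc0' : c 0 = 1 := by simp [hc]
      have hcm1 : c (-1) = φ := by simp [hc]
      have hc2 : c 2 = φ⁻¹ ^ 2 := by simp only [hc]; rw [zpow_neg, zpow_ofNat, inv_pow]
      have hcm2 : c (-2) = φ ^ 2 := by simp only [hc, neg_neg]; exact zpow_ofNat φ 2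
      rw [hc1, hc0', hcm1, hc2, hcm2] at keyW
      -- load part: on the support of `L(z,·)` the offset is `≤ 2R+1`, so `v w ≤ φ^{-(2R+1)} v z`
      have keyL : ∑ w ∈ nbr z, L z w * v w ≤ Λ * (φ⁻¹ ^ (2 * R + 1) * v z) := by
        have hterm : ∀ w ∈ nbr z, L z w * v w ≤ L z w * (φ⁻¹ ^ (2 * R + 1) * v z) := by
          intro w hw
          refine mul_le_mul_of_nonneg_left ?_ (hL0 z w)
          have hoff := abs_offset_le_of_norm_le (hnbr z w hw) i
          refine (hratio w).trans (mul_le_mul_of_nonneg_right ?_ (hv0 z))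
          simp only [hc]
          rw [← zpow_natCast, inv_zpow', show ((2 * R + 1 : ℕ) : ℤ) = 2 * (R : ℤ) + 1 by push_cast; ring]
          refine zpow_le_zpow_right_of_le_one₀ hφ0 hφ1 ?_
          rw [abs_le] at hoff; linarith [hoff.1]
        calc ∑ w ∈ nbr z, L z w * v w ≤ ∑ w ∈ nbr z, L z w * (φ⁻¹ ^ (2 * R + 1) * v z) := Finset.sum_le_sum hterm
          _ = (∑ w ∈ nbr z, L z w) * (φ⁻¹ ^ (2 * R + 1) * v z) := (Finset.sum_mul _ _ _).symm
          _ ≤ Λ * (φ⁻¹ ^ (2 * R + 1) * v z) :=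
              mul_le_mul_of_nonneg_right (hLrow z) (mul_nonneg (pow_nonneg (inv_nonneg.2 hφ0.le) _) (hv0 z))
      calc ∑ w ∈ nbr z, C z w * v w ≤ ∑ w ∈ nbr z, (A * linkInfluence z w + L z w) * v w :=
            Finset.sum_le_sum fun w hw => mul_le_mul_of_nonneg_right (hsplit z w hw) (hv0 w)
        _ = A * ∑ w ∈ nbr z, (linkInfluence z w : ℝ) * v w + ∑ w ∈ nbr z, L z w * v w := by
            rw [Finset.mul_sum, ← Finset.sum_add_distrib]; exact Finset.sum_congr rfl fun w _ => by ring
        _ ≤ A * ((if z.2 = i then 2 * ((d - 1 : ℕ) : ℝ) * (φ⁻¹ + 1 + φ)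
              else φ⁻¹ ^ 2 + 2 * φ⁻¹ + 2 * φ + φ ^ 2 + 6 * ((d - 2 : ℕ) : ℝ) * 1) * v z) + Λ * (φ⁻¹ ^ (2 * R + 1) * v z) :=
            add_le_add (mul_le_mul_of_nonneg_left keyW hA) keyL
        _ ≤ 1 * v z := by
            split_ifs with hzi
            · calc _ = (A * (2 * ((d - 1 : ℕ) : ℝ) * (φ⁻¹ + 1 + φ)) + Λ * φ⁻¹ ^ (2 * R + 1)) * v z := by ring
                _ ≤ 1 * v z := mul_le_mul_of_nonneg_right hpar (hv0 z)
            · calc _ = (A * (φ⁻¹ ^ 2 + 2 * φ⁻¹ + 2 * φ + φ ^ 2 + 6 * ((d - 2 : ℕ) : ℝ)) + Λ * φ⁻¹ ^ (2 * R + 1)) * v z := by ring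
                _ ≤ 1 * v z := mul_le_mul_of_nonneg_right hperp (hv0 z)
        _ = v z := one_mul _
  have hcov := abs_covariance_le_of_supersolution_of_lt_one hγ hKR (r := suFrobDist) (R := 2 * Real.sqrt N)
    suFrobDist_nonneg suFrobDist_le (by positivity) hρ0 hρ1 hrow hμ hfm hfdep hMf hδf hgm hgdep hMg hδg hv0 hvg hsuper
  refine hcov.trans ?_
  have hvf : ∀ x ∈ Δf, min 1 (v x) ≤ φ ^ (2 * n) := by
    intro x hx
    refine (min_le_right _ _).trans ?_
    simp only [hv]
    rw [← zpow_natCast]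
    refine zpow_le_zpow_right_of_le_one₀ hφ0 hφ1 ?_
    have := hfa x hx
    simp only [hH] at this ⊢
    push_cast
    exact le_max_of_le_left (by omega)
  have hsum : ∑ x ∈ Δf, min 1 (v x) * δf x ≤ ∑ x ∈ Δf, φ ^ (2 * n) * δf x :=
    Finset.sum_le_sum fun x hx => mul_le_mul_of_nonneg_right (hvf x hx) (hδf.nonneg x)
  have hδg0 : 0 ≤ ∑ y ∈ Δg, δg y := Finset.sum_nonneg fun y _ => hδg.nonneg y
  have hN8 : (2 : ℝ) * (2 * Real.sqrt N) ^ 2 = 8 * N := by rw [mul_pow, Real.sq_sqrt (Nat.cast_nonneg N)]; ring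
  calc 2 * (2 * Real.sqrt N) ^ 2 * (∑ y ∈ Δg, δg y) * ∑ x ∈ Δf, min 1 (v x) * δf x
      ≤ 2 * (2 * Real.sqrt N) ^ 2 * (∑ y ∈ Δg, δg y) * ∑ x ∈ Δf, φ ^ (2 * n) * δf x :=
        mul_le_mul_of_nonneg_left hsum (mul_nonneg (by positivity) hδg0)
    _ = 8 * N * (∑ y ∈ Δg, δg y) * (∑ x ∈ Δf, δf x) * φ ^ (2 * n) := by rw [hN8, ← Finset.mul_sum]; ring

/-- **AXIS-RATE CLUSTERING UNIFORM IN THE TIER-1 LOADS (KR door; no `MemBallZdW` hypothesis).**  `d ≥ 2`, `N ≥ 1`, 't Hooft `β`, `OneLinkKRModulus N b K` on `b ≥ 2(d−1)|β|`; a member: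
a link potential `W` (adapted, termwise bounded, supported by `supp`) with oscillation load `≤ a`, self-Lipschitz load `≤ ℓ_s`, cross-Lipschitz load `≤ Λ`, range
`‖e − y‖∞ ≤ R` on the listed sets through `e` (`R ≥ 1` natural); `A = K e^{a}(1 + 2√N ℓ_s)|β|`, row condition `6(d−1)|β|·K e^{a}(1+2√Nℓ_s) + √N Λ < 1`.  If
`0 < φ ≤ 1` satisfies `A·2(d−1)(φ⁻¹+1+φ) + √NΛ φ⁻¹^{2R+1} ≤ 1` and `A(φ⁻¹²+2φ⁻¹+2φ+φ²+6(d−2)) + √NΛ φ⁻¹^{2R+1} ≤ 1`, then EVERY DLR state of the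
member and all axis-separated bounded local Lipschitz `f, g` satisfy `|cov_μ(f,g)| ≤ 8N(Σδ_g)(Σδ_f) φ^{2n}`. [folklore] -/
theorem perturbedYM_abs_cov_le_axis (hd : 2 ≤ d) (hN : 1 ≤ N) {β b K a ℓs Λ : ℝ} (hK : 0 ≤ K) (hℓs : 0 ≤ ℓs)
    (hb : |β| * (2 * ((d : ℝ) - 1)) ≤ b) (hmod : OneLinkKRModulus N b K)
    {W : Potential (ZdEdge d) (Matrix.specialUnitaryGroup (Fin N) ℂ)} (hW : W.IsAdapted) (hWb : ∀ X, ∃ C, ∀ U, |W X U| ≤ C)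
    {supp : Finset (ZdEdge d) → Finset (Finset (ZdEdge d))} (hsupp : W.IsSupportedBy supp)
    {osc : Finset (ZdEdge d) → ZdEdge d → ℝ} (hosc : ∀ X, Dobrushin.IsOscBound (W X) (osc X))
    (hosca : ∀ e, ∑ X ∈ (supp {e}).filter (fun X => e ∈ X), osc X e ≤ a)
    {lip : Finset (ZdEdge d) → ZdEdge d → ℝ} (hlip : ∀ X, IsLipBound suFrobDist (W X) (lip X))
    (hlips : ∀ e, ∑ X ∈ (supp {e}).filter (fun X => e ∈ X), lip X e ≤ ℓs)
    (hΛ : ∀ e, ∑ y ∈ perturbedNbr supp e, ∑ X ∈ (supp {e}).filter (fun X => e ∈ X), lip X y ≤ Λ)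
    {R : ℕ} (hR1 : 1 ≤ R) (hR : ∀ e, ∀ X ∈ supp {e}, e ∈ X → ∀ y ∈ X, ‖e.1 - y.1‖ ≤ (R : ℝ))
    (hρ : 6 * ((d : ℝ) - 1) * |β| * (K * exp a * (1 + 2 * Real.sqrt N * ℓs)) + Real.sqrt N * Λ < 1)
    {φ : ℝ} (hφ0 : 0 < φ) (hφ1 : φ ≤ 1)
    (hpar : K * exp a * (1 + 2 * Real.sqrt N * ℓs) * |β| * (2 * ((d - 1 : ℕ) : ℝ) * (φ⁻¹ + 1 + φ)) +
      Real.sqrt N * Λ * φ⁻¹ ^ (2 * R + 1) ≤ 1)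
    (hperp : K * exp a * (1 + 2 * Real.sqrt N * ℓs) * |β| * (φ⁻¹ ^ 2 + 2 * φ⁻¹ + 2 * φ + φ ^ 2 + 6 * ((d - 2 : ℕ) : ℝ)) +
      Real.sqrt N * Λ * φ⁻¹ ^ (2 * R + 1) ≤ 1)
    {μ : Measure (LGConfig d (Matrix.specialUnitaryGroup (Fin N) ℂ))}
    (hμ : μ ∈ perturbedGibbsMeasures (d := d) (fundamentalRep (Fin N)) (N * β) W supp)
    {f g : LGConfig d (Matrix.specialUnitaryGroup (Fin N) ℂ) → ℝ} (hfm : Measurable f) {Δf : Finset (ZdEdge d)}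
    (hfdep : DependsOn f (↑Δf : Set (ZdEdge d))) {Mf : ℝ} (hMf : ∀ σ, |f σ| ≤ Mf) {δf : ZdEdge d → ℝ}
    (hδf : IsLipBound suFrobDist f δf) (hgm : Measurable g) {Δg : Finset (ZdEdge d)}
    (hgdep : DependsOn g (↑Δg : Set (ZdEdge d))) {Mg : ℝ} (hMg : ∀ σ, |g σ| ≤ Mg) {δg : ZdEdge d → ℝ}
    (hδg : IsLipBound suFrobDist g δg) (i : Fin d) (a' : ℤ) (n : ℕ)
    (hga : ∀ y ∈ Δg, a' ≤ 2 * y.1 i + (if y.2 = i then 1 else 0))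
    (hfa : ∀ x ∈ Δf, 2 * x.1 i + (if x.2 = i then 1 else 0) + 2 * n ≤ a') :
    |cov[f, g; μ]| ≤ 8 * N * (∑ y ∈ Δg, δg y) * (∑ x ∈ Δf, δf x) * φ ^ (2 * n) := by
  classical
  haveI : SecondCountableTopology (Matrix (Fin N) (Fin N) ℂ) :=
    inferInstanceAs (SecondCountableTopology (Fin N → Fin N → ℂ))
  haveI : SecondCountableTopology (Matrix.specialUnitaryGroup (Fin N) ℂ) :=
    Topology.IsEmbedding.subtypeVal.secondCountableTopology
  have hd1 : 1 ≤ d := by omega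
  have hγ : IsSpecification (perturbedYM (d := d) (fundamentalRep (Fin N)) (N * β) W supp) :=
    isSpecification_perturbedYM _ (continuous_fundamentalRep (Fin N)) _ hW hWb hsupp
  have hKR := isKRContraction_perturbedYM_of_oneLinkKRModulus hd1 hN hK hℓs hb hmod hW (supp := supp) hosc hosca hlip hlips
  have hrows := sum_perturbedNbr_coeffKR_le (N := N) hd1 (β := β) (a := a) hK hℓs hΛ
  have hμ' : IsGibbsMeasure (perturbedYM (d := d) (fundamentalRep (Fin N)) (N * β) W supp) μ := hμ
  set A : ℝ := K * exp a * (1 + 2 * Real.sqrt N * ℓs) * |β| with hA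
  have hA0 : 0 ≤ A := by positivity
  have hρ0 : 0 ≤ 6 * ((d : ℝ) - 1) * |β| * (K * exp a * (1 + 2 * Real.sqrt N * ℓs)) + Real.sqrt N * Λ := by
    let e₀ : ZdEdge d := (0, ⟨0, by omega⟩)
    exact (Finset.sum_nonneg fun y _ => hKR.nonneg e₀ y).trans (hrows e₀)
  refine abs_cov_le_axis_of_split hd hγ hKR hρ0 hρ hrows hA0
    (L := fun e y => Real.sqrt N * ∑ X ∈ (supp {e}).filter (fun X => e ∈ X), lip X y)
    (fun e y => mul_nonneg (Real.sqrt_nonneg _) (Finset.sum_nonneg fun X _ => (hlip X).nonneg y))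
    (fun e y _ => by rw [hA]) (Λ := Real.sqrt N * Λ)
    (fun e => by rw [← Finset.mul_sum]; exact mul_le_mul_of_nonneg_left (hΛ e) (Real.sqrt_nonneg _))
    (R := R) (fun e y hy => ?_) hφ0 hφ1 (by rw [hA]; exact hpar) (by rw [hA]; exact hperp)
    hμ' hfm hfdep hMf hδf hgm hgdep hMg hδg i a' n hga hfa
  -- the range of the neighbourhoods: plaquette neighbours at distance `≤ 1`, listed sets at distance `≤ R`
  rcases (mem_perturbedNbr_iff.1 hy).2 with hy' | ⟨X, hX, hxX, hyX⟩
  · exact (norm_sub_le_one_of_mem_linkPlaqNbr hy').trans (by exact_mod_cast hR1)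
  · exact hR e X hX hxX y hyX


/-- ★ **Every `N ≥ 2`, `d = 4`, hypothesis-free (Bakry–Émery modulus), CLOSED FORM**: at 't Hooft coupling `0 < b ≤ 1/64` (bare `Nb`), with
`κ = b/(1/2 − 6b)` and `φ = 2√κ`, EVERY DLR state of the `SU(N)` Wilson specification on `ℤ⁴` and all axis-separated bounded local Lipschitz `f, g`
satisfy `|cov_μ(f,g)| ≤ 8N(Σδ_g)(Σδ_f) φ^{2n}` — rate `log(1/(4κ)) = log((1 − 12b)/(8b))` per lattice unit, `N`-uniform in 't Hooft scaling
(conditions at `s = √κ ≤ 1/5`: `3s + 6s² + 12s³ ≤ 0.94`, `1/4 + s + 12s² + 4s³ + 4s⁴ ≤ 0.97`). [cite: arXiv220412737, Lemma 4.1] -/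
theorem suN_abs_cov_le_axis_dim4 (hN : 2 ≤ N) {b : ℝ} (hb0 : 0 < b) (hb : b ≤ 1 / 64)
    {μ : Measure (LGConfig 4 (Matrix.specialUnitaryGroup (Fin N) ℂ))}
    (hμ : μ ∈ ymGibbsMeasures (d := 4) (fundamentalRep (Fin N)) (N * b))
    {f g : LGConfig 4 (Matrix.specialUnitaryGroup (Fin N) ℂ) → ℝ} (hfm : Measurable f) {Δf : Finset (ZdEdge 4)}
    (hfdep : DependsOn f (↑Δf : Set (ZdEdge 4))) {Mf : ℝ} (hMf : ∀ σ, |f σ| ≤ Mf) {δf : ZdEdge 4 → ℝ}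
    (hδf : IsLipBound suFrobDist f δf) (hgm : Measurable g) {Δg : Finset (ZdEdge 4)}
    (hgdep : DependsOn g (↑Δg : Set (ZdEdge 4))) {Mg : ℝ} (hMg : ∀ σ, |g σ| ≤ Mg) {δg : ZdEdge 4 → ℝ}
    (hδg : IsLipBound suFrobDist g δg) (i : Fin 4) (a : ℤ) (n : ℕ)
    (hga : ∀ y ∈ Δg, a ≤ 2 * y.1 i + (if y.2 = i then 1 else 0))
    (hfa : ∀ x ∈ Δf, 2 * x.1 i + (if x.2 = i then 1 else 0) + 2 * n ≤ a) :
    |cov[f, g; μ]| ≤ 8 * N * (∑ y ∈ Δg, δg y) * (∑ x ∈ Δf, δf x) * (2 * Real.sqrt (b / (1 / 2 - 6 * b))) ^ (2 * n) := by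
  have hN1 : 1 ≤ N := by omega
  have habs : |b| = b := abs_of_pos hb0
  have hlt : |b| * (2 * (((4 : ℕ) : ℝ) - 1)) < 1 / 2 := by rw [habs]; push_cast; nlinarith
  have hmod := Balaban1983to89.StrongCouplingKernelWindow.oneLinkKRModulus_SU hN hlt
  have hden : 0 < 1 / 2 - 6 * b := by linarith
  set κ : ℝ := b / (1 / 2 - 6 * b) with hκ
  have hκ0 : 0 < κ := div_pos hb0 hden
  have hκ26 : κ ≤ 1 / 26 := by rw [hκ, div_le_iff₀ hden]; linarith
  set s : ℝ := Real.sqrt κ with hs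
  have hs0 : 0 < s := Real.sqrt_pos.2 hκ0
  have hs2 : s ^ 2 = κ := Real.sq_sqrt hκ0.le
  have hs5 : s ≤ 1 / 5 := by nlinarith [hs2, hs0]
  have hK : (1 : ℝ) / (1 / 2 - |b| * (2 * (((4 : ℕ) : ℝ) - 1))) = κ / b := by
    rw [habs, hκ]; push_cast; field_simp; ring
  have hKb : 1 / (1 / 2 - |b| * (2 * (((4 : ℕ) : ℝ) - 1))) * |b| = s ^ 2 := by
    rw [hK, habs, hs2]; field_simp
  have hφ0 : 0 < 2 * s := by linarith
  have hφ1 : 2 * s ≤ 1 := by linarith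
  have hsne : s ≠ 0 := hs0.ne'
  have hpar : 1 / (1 / 2 - |b| * (2 * (((4 : ℕ) : ℝ) - 1))) * |b| * (2 * ((4 - 1 : ℕ) : ℝ) * ((2 * s)⁻¹ + 1 + 2 * s)) ≤ 1 := by
    rw [hKb]
    have e : s ^ 2 * (2 * ((4 - 1 : ℕ) : ℝ) * ((2 * s)⁻¹ + 1 + 2 * s)) = 3 * s + 6 * s ^ 2 + 12 * s ^ 3 := by
      push_cast; field_simp; ring
    rw [e]; nlinarith [pow_pos hs0 3, pow_le_pow_left₀ hs0.le hs5 2, pow_le_pow_left₀ hs0.le hs5 3]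
  have hperp : 1 / (1 / 2 - |b| * (2 * (((4 : ℕ) : ℝ) - 1))) * |b| *
      ((2 * s)⁻¹ ^ 2 + 2 * (2 * s)⁻¹ + 2 * (2 * s) + (2 * s) ^ 2 + 6 * ((4 - 2 : ℕ) : ℝ)) ≤ 1 := by
    rw [hKb]
    have e : s ^ 2 * ((2 * s)⁻¹ ^ 2 + 2 * (2 * s)⁻¹ + 2 * (2 * s) + (2 * s) ^ 2 + 6 * ((4 - 2 : ℕ) : ℝ)) =
        1 / 4 + s + 12 * s ^ 2 + 4 * s ^ 3 + 4 * s ^ 4 := by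
      push_cast; field_simp; ring
    rw [e]
    nlinarith [pow_pos hs0 3, pow_pos hs0 4, pow_le_pow_left₀ hs0.le hs5 2, pow_le_pow_left₀ hs0.le hs5 3,
      pow_le_pow_left₀ hs0.le hs5 4]
  have hρ : 6 * (((4 : ℕ) : ℝ) - 1) * |b| * (1 / (1 / 2 - |b| * (2 * (((4 : ℕ) : ℝ) - 1)))) < 1 := by
    have e : 6 * (((4 : ℕ) : ℝ) - 1) * |b| * (1 / (1 / 2 - |b| * (2 * (((4 : ℕ) : ℝ) - 1)))) = 18 * κ := by
      have : 6 * (((4 : ℕ) : ℝ) - 1) * |b| * (1 / (1 / 2 - |b| * (2 * (((4 : ℕ) : ℝ) - 1)))) =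
          18 * (1 / (1 / 2 - |b| * (2 * (((4 : ℕ) : ℝ) - 1))) * |b|) := by push_cast; ring
      rw [this, hKb, hs2]
    rw [e]; linarith
  have h := ym_abs_cov_le_axis (d := 4) (N := N) (by norm_num) hN1 (β := b) (K := 1 / (1 / 2 - |b| * (2 * (((4 : ℕ) : ℝ) - 1))))
    (by positivity) le_rfl hmod hφ0 hφ1 hpar hperp hρ hμ hfm hfdep hMf hδf hgm hgdep hMg hδg i a n hga hfa
  rw [hs] at h
  exact h

end Summit.Ventures.YMGap.RobustBall.ZdAxis

end
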